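import Literature.AlgebraicGeometry.HodgeTheory.DiagonalSymmetryInvariantEigenHodgeNumbers
import Literature.AlgebraicGeometry.HodgeTheory.HypersurfaceEigenHodgeNumbersJacobian
import Literature.AlgebraicGeometry.Motives.GeneralNonsingularForms
import Literature.AlgebraicGeometry.Motives.NonsingularFormIrreducible
import Literature.AlgebraicGeometry.Motives.AbstractHodgeTate
import HarnessLib

/-!
# Voisin's equivariant eigen-Hodge numbers of a diagonal symmetry of a smooth hypersurface follow from
# Griffiths' residue package with primitivity (Voisin II Thm. 6.10 / Cor. 6.12, §6.1.3; all dimensions,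
# all eigenvalues)

Family `hodge`, layer `Literature/AlgebraicGeometry/HodgeTheory`. PROOF FILE (theorems only; no definition,
no named fact). The named fact `voisin2003_finrank_eigenspace_inf_hodgePiece_of_diagonalStabilizer`
(`HypersurfaceEigenHodgeNumbersJacobian`; binder `stub_voisinEigenHodgeNumbers` of crux K1-B
`VeryGeneralSignCommutatorsInHg` of `Summits/HodgeConjecture/HodgeConjecture/Theses/SignSymmetricPowers.lean`)
is DERIVED from the residue package with primitivity `Griffiths1969_residues_primitive`
(`GriffithsResiduesPrimitive`, also the input of crux K1-A of route `CyclicUnitaryPowers` through its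
projection `Griffiths1969_residueKernel_eq_jacobianIdeal`): so the two K1 cruxes of the cell share ONE
residue fact. The assembly:

* odd `n`: `DiagonalSymmetryEigenHodgeNumbers.finrank_eigenspace_inf_piece_eq_of_residueKernel` (all `μ`)
  and `piece_eq_bot_of_residues` (below the Jacobian range);
* even `n`, `μ ≠ 1`: `DiagonalSymmetryEigenHodgeNumbersAllDimensions.finrank_eigenspace_inf_piece_eq_of_residueKernel_of_ne_one`
  and `eigenspace_inf_piece_eq_bot_of_lt_of_ne_one`;
* even `n = 2m`, `μ = 1`: `DiagonalSymmetryInvariantEigenHodgeNumbers.finrank_eigenspace_one_inf_piece_eq_of_residues_primitive`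
  and `DiagonalSymmetryHyperplaneLine.finrank_eigenspace_one_inf_piece_eq_of_lt_of_residues_primitive`
  (the hyperplane line `ℂ·h^m ⊆ H^{m,m}` contributes the `+1` at `2q = n`; a nonsingular form of degree
  `d ≥ 1` in `≥ 3` variables is irreducible, and `d = 0` is excluded since `V₊(unit) = ∅` is not a variety);
* the eigenvalue conventions: `T_a = (∏ aᵢ) · (P ↦ P(a • x))`, so the `μ`-eigenspace of `T_a` is the
  `μ (∏ aᵢ)⁻¹`-eigenspace of the substitution.

Written by the prover seat `hodge-nonav-prover-Bx` (cell `hodge-nonav`). CONDITIONAL on the cited residue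
package; nothing here says HC ∕ HC_AV is proved.

## References
* [VoisinHodgeII2003] C. Voisin, Hodge Theory and Complex Algebraic Geometry II, CUP 2003, §6.1.3
  (`α_p`), Rem. 6.8, Thm. 6.10, Cor. 6.12 (held text chunks p0159, p0161); §1.2.3 Cor. 1.24–1.25.
* [CarlsonToledo1999] J. A. Carlson, D. Toledo, Duke Math. J. 97 (1999), §5 (held text p0011–p0012).
* [Griffiths1969] P. Griffiths, On the periods of certain rational integrals I, II, Ann. of Math. 90 (1969), §8.
-/

noncomputable section

open CategoryTheory AlgebraicGeometry MvPolynomial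
open scoped TensorProduct

namespace Literature.AlgebraicGeometry.HodgeTheory

open Literature.AlgebraicGeometry.Motives Literature.AlgebraicTopology.SingularHomology
open Literature.RingTheory.MvPolynomial (idealDegree mem_idealDegree)

section HodgeTheory

variable {n : ℕ}

/-- The `μ`-eigenspace of the twisted action `T_a = (∏ aᵢ) · (P ↦ P(a • x))` is the `μ (∏ aᵢ)⁻¹`-eigenspace
of the substitution `P ↦ P(a • x)`. [cite: VoisinHodgeII2003, §6.1.3 (held text chunk p0159)] -/
theorem eigenspace_aeval_diagonalSubst_eq_eigenspace_twistedDiagonalAction (a : Fin (n + 2) → ℂˣ) (μ : ℂ) :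
    Module.End.eigenspace (MvPolynomial.aeval (diagonalSubst a)).toLinearMap (μ * (∏ i, ((a i : ℂˣ) : ℂ))⁻¹) =
      Module.End.eigenspace (twistedDiagonalAction a) μ := by
  have hc : (∏ i, ((a i : ℂˣ) : ℂ)) ≠ 0 := Finset.prod_ne_zero_iff.mpr fun i _ ↦ (a i).ne_zero
  ext P
  rw [Module.End.mem_eigenspace_iff, Module.End.mem_eigenspace_iff, twistedDiagonalAction_apply,
    AlgHom.toLinearMap_apply]
  constructor
  · intro h
    rw [h, smul_smul, mul_comm, mul_assoc, inv_mul_cancel₀ hc, mul_one]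
  · intro h
    have h' := congrArg (fun Q ↦ (∏ i, ((a i : ℂˣ) : ℂ))⁻¹ • Q) h
    simp only [smul_smul, inv_mul_cancel₀ hc, one_smul] at h'
    rw [h', mul_comm]

/-- **An empty hypersurface is not a variety**: if `V₊(F)` is smooth projective of dimension `n` then `F` is
not a unit (the structure `IsSmoothProjective` makes `V₊(F)` irreducible, hence non-empty, while a unit has
empty zero locus). [cite: Hartshorne1977, I Ex. 5.8] -/
theorem not_isUnit_of_isSmoothProjective_hypersurface {F : MvPolynomial (Fin (n + 2)) ℂ}
    (hX : IsSmoothProjective n (SmoothHypersurface.hypersurface F)) : ¬ IsUnit F := by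
  classical
  letI := MvPolynomial.gradedAlgebra (σ := Fin (n + 2)) (R := ℂ)
  intro hu
  haveI := IsSmoothProjective.irreducibleSpace hX
  obtain ⟨x⟩ := (inferInstance : Nonempty ↥(SmoothHypersurface.hypersurface F).left)
  have hx : (SmoothHypersurface.hypersurfaceι F).left.base x ∈
      Set.range (SmoothHypersurface.hypersurfaceι F).left.base := ⟨x, rfl⟩
  rw [SmoothHypersurface.range_hypersurfaceι] at hx
  have hempty : ProjectiveSpectrum.zeroLocus (homogeneousSubmodule (Fin (n + 2)) ℂ) {F} = ∅ := by
    ext p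
    simp only [Set.mem_empty_iff_false, iff_false]
    intro hp
    rw [ProjectiveSpectrum.mem_zeroLocus, Set.singleton_subset_iff, SetLike.mem_coe] at hp
    exact p.isPrime.ne_top (Ideal.eq_top_of_isUnit_mem _ hp hu)
  rw [hempty] at hx
  exact Set.notMem_empty _ hx

/-- **Voisin's equivariant eigen-Hodge numbers via the Jacobian ring follow from Griffiths' residue package
with primitivity** (all `n ≥ 1`, all eigenvalues `μ`, all `q ≤ n`): the named fact
`voisin2003_finrank_eigenspace_inf_hodgePiece_of_diagonalStabilizer` holds granted
`Griffiths1969_residues_primitive`. Odd `n` and `μ ≠ 1` need only clauses (i)–(iv); `μ = 1` in even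
dimension `2m` needs the primitivity clause (v) to separate the residues from the hyperplane line
`ℂ·h^m ⊆ H^{m,m}`, which contributes the summand `[μ = 1 ∧ 2q = n]`. CONDITIONAL (residue package cited).
[cite: VoisinHodgeII2003, §6.1.3 Thm. 6.10 and Cor. 6.12 (held text chunks p0159, p0161)]
[cite: CarlsonToledo1999, §5 (held text p0011–p0012)] -/
theorem voisin2003_finrank_eigenspace_inf_hodgePiece_of_diagonalStabilizer_of_residues_primitive
    (hG : Griffiths1969_residues_primitive) :
    voisin2003_finrank_eigenspace_inf_hodgePiece_of_diagonalStabilizer := by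
  intro hHD n d hn F hF hNS hX a ha μ q hq
  classical
  have hI : hodgePQ_independent_of_hodgeModel := hodgePQ_independent_of_hodgeModel_holds
  have hG3 : Griffiths1969_residueKernel_eq_jacobianIdeal :=
    Griffiths1969_residueKernel_eq_jacobianIdeal_of_residues_primitive hG
  have hGs : Griffiths1969_residues_span_hodgeFiltration :=
    Griffiths1969_residues_span_hodgeFiltration_of_residues_primitive hG
  have hJ : ∀ z : Fin (n + 2) → ℂ, z ≠ 0 → MvPolynomial.eval z F = 0 →
      ∃ j, MvPolynomial.eval z (MvPolynomial.pderiv j F) ≠ 0 :=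
    fun z hz hFz ↦ SmoothHypersurface.IsNonsingularForm.exists_eval_pderiv_ne_zero hNS hz hFz
  rw [eigenspace_aeval_diagonalSubst_eq_eigenspace_twistedDiagonalAction]
  rcases Nat.even_or_odd n with ⟨m, hm⟩ | hodd
  · -- even `n = m + m`
    have hnm : n = 2 * m := by omega
    have hm1 : 1 ≤ m := by omega
    by_cases hμ : μ = 1
    · -- the invariant eigenvalue
      subst hμ
      -- `d ≥ 1` (an empty hypersurface is not a variety), so `F` is irreducible
      have hd : 1 ≤ d := by
        by_contra hd0
        have hd0' : d = 0 := by omega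
        subst hd0'
        have hF0 : F ≠ 0 := hNS.ne_zero
        apply not_isUnit_of_isSmoothProjective_hypersurface hX
        have htd : F.totalDegree = 0 := hF.totalDegree hF0
        rw [MvPolynomial.totalDegree_eq_zero_iff_eq_C] at htd
        have hc : MvPolynomial.coeff 0 F ≠ 0 := fun h ↦ hF0 (by rw [htd, h, map_zero])
        rw [htd]
        exact (isUnit_iff_ne_zero.mpr hc).map MvPolynomial.C
      have hirr : Irreducible F := SmoothHypersurface.IsNonsingularForm.irreducible hn hd hF hNS
      by_cases hlt : (q + 1) * d < n + 2
      · rw [if_pos hlt, zero_add,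
          finrank_eigenspace_one_inf_piece_eq_of_lt_of_residues_primitive hG hHD hI hnm hm1 hF hirr hJ hX ha
            hq hlt]
        by_cases hqm : q = m
        · rw [if_pos hqm, if_pos ⟨rfl, by omega⟩]
        · rw [if_neg hqm, if_neg (fun h ↦ hqm (by omega))]
      · rw [if_neg hlt]
        have hk : ((q + 1) * d - (n + 2)) + (n + 2) = (q + 1) * d := by omega
        have h := finrank_eigenspace_one_inf_piece_eq_of_residues_primitive hG hHD hI hnm hm1 hF hirr hJ
          hX ha hq hk
        have hle : Module.finrank ℂ ↥(Module.End.eigenspace (twistedDiagonalAction a) 1 ⊓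
            idealDegree (UniversalHypersurface.jacobianIdeal F) ((q + 1) * d - (n + 2))) ≤
            Module.finrank ℂ ↥(Module.End.eigenspace (twistedDiagonalAction a) 1 ⊓
              homogeneousSubmodule (Fin (n + 2)) ℂ ((q + 1) * d - (n + 2))) := by
          haveI : Module.Finite ℂ ↥(homogeneousSubmodule (Fin (n + 2)) ℂ ((q + 1) * d - (n + 2))) :=
            Module.Finite.iff_fg.mpr (homogeneousSubmodule_fg (Fin (n + 2)) ℂ _)
          haveI : FiniteDimensional ℂ ↥(Module.End.eigenspace (twistedDiagonalAction a) 1 ⊓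
              homogeneousSubmodule (Fin (n + 2)) ℂ ((q + 1) * d - (n + 2))) :=
            Submodule.finiteDimensional_inf_right _ _
          exact Submodule.finrank_mono (inf_le_inf_left _ inf_le_right)
        by_cases hqm : q = m
        · rw [if_pos hqm] at h
          rw [if_pos ⟨rfl, by omega⟩]
          omega
        · rw [if_neg hqm] at h
          rw [if_neg (fun h' ↦ hqm (by omega))]
          omega
    · -- `μ ≠ 1`
      rw [if_neg (show ¬(μ = 1 ∧ 2 * q = n) from fun h ↦ hμ h.1), add_zero]
      by_cases hlt : (q + 1) * d < n + 2
      · rw [if_pos hlt, eigenspace_inf_piece_eq_bot_of_lt_of_ne_one hGs hHD hn hF hJ hX ha hμ hq hlt,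
          finrank_bot]
      · rw [if_neg hlt]
        have hk : ((q + 1) * d - (n + 2)) + (n + 2) = (q + 1) * d := by omega
        exact finrank_eigenspace_inf_piece_eq_of_residueKernel_of_ne_one hG3 hHD hI hn hF hJ hX ha hμ hq hk
  · -- odd `n`: no middle term
    rw [if_neg (show ¬(μ = 1 ∧ 2 * q = n) from fun h ↦ by obtain ⟨r, hr⟩ := hodd; omega), add_zero]
    by_cases hlt : (q + 1) * d < n + 2
    · rw [if_pos hlt, piece_eq_bot_of_residues hGs hHD hodd hF hJ hX hq hlt]
      simp
    · rw [if_neg hlt]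
      have hk : ((q + 1) * d - (n + 2)) + (n + 2) = (q + 1) * d := by omega
      exact finrank_eigenspace_inf_piece_eq_of_residueKernel hG3 hHD hI hodd hF hJ hX ha μ hq hk

end HodgeTheory

end Literature.AlgebraicGeometry.HodgeTheory

end
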